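import Literature.Probability.RandomPlanarGeometry.SAWCountZdTopCoefficients
import Literature.Probability.RandomPlanarGeometry.SAWIrreducibleBridgeSpanOne
import Literature.Probability.RandomPlanarGeometry.SAWPulledLargeForceExpansionZdDegreeProfile
import Literature.Probability.RandomPlanarGeometry.SAWPulledLargeForceExpansionZdTopSymbol
import Literature.Probability.RandomPlanarGeometry.SAWPulledLargeForceExpansionZdFourthOrder
import HarnessLib

/-!
# Pulled SAW on `ℤ^{d+1}`: the SECOND SYMBOL of the cost census and the LEADING COEFFICIENT `(−2)^{k−1}` of `c_k^{(d)}` in the dimension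

Topic `Literature/Probability/RandomPlanarGeometry` (continues `SAWPulledLargeForceExpansionZdTopSymbol.lean`: `deg_d c_k^{(d)} ≤ k − 1`
with vanishing `d^k`-coefficient, `exists_polynomial_largeForceCoeffZd_topCoeff_zero`; uses `SAWCountZdTopCoefficients.lean`: the top two
coefficients `2^n, −(n−1)2^{n−1}` of `c_n(ℤ^d)` in `d` (`exists_polynomial_count_topTwo'`); `SAWIrreducibleBridgeSpanOne.lean`:
`costCoeffZd_self_succ : N_{c,c+1}(ℤ^{d+1}) = c_c(ℤ^d)`; `SAWPulledLargeForceExpansionZdDegreeProfile.lean`: `deg_d N_{c,n} ≤ 3c + 2 − 2n`;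
`SAWPulledLargeForceExpansionZdFourthOrder.lean`: `costCoeffZd_eq_zero_of_le`; and the tree's cost-series engine `CostSeries.Pz / A / E`,
`largeForceCoeffZd d k = c_k^{(d)} = [X^k] E_k`).

PRINTED CONTEXT (locators only; nothing below is quoted digit-for-digit). Madras–Slade (1993) §1.1 eq. (1.1.8) p. 5 (the `1/d` expansion of
`μ`, Fisher–Sykes 1959 / Fisher–Gaunt 1964) and §4.2 eq. (4.2.20)–(4.2.22) (cost = length − span of a bridge). NOT IN PRINT (lane statements, new
in writing as far as the lane's search found): everything below — the objects `c_k^{(d)}` (large-force coefficients of the pulled self-avoiding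
walk on `ℤ^{d+1}`) are the lane's.

PART I — SECOND-ORDER SYMBOL CALCULUS (inline predicate `∃ P, natDegree P ≤ m ∧ [X^m]P = a ∧ [X^m](P·X) = b ∧ ∀ d, f d = P(d)`; the second
coefficient is carried as `[X^m](P·X)` so that products obey `(a,b)(a',b') = (aa', ab' + ba')` uniformly in `m`, via `Polynomial.reflect`).
PART II — ★★ `exists_polynomial_costCoeffZd_topTwo` — THE SECOND SYMBOL OF THE COST CENSUS: for `c ≥ 1` the `d^c`- and `d^{c−1}`-coefficients
of `N_{c,n}(ℤ^{d+1})` are `(2^c, −(c−1)2^{c−1})` on the span-one cell `n = c + 1` and `(0, 0)` elsewhere.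
PART III — ★ `exists_symbolPair_coeff_A` — the symbol PAIRS of `[X^i] A_K` converge: top symbols to `ι = (1+2X)⁻¹` (as in the TopSymbol file)
and second symbols to `θ = 2X²ι³`; the second-order recursion `τ ↦ −Σ_c X^c (2^c (c+1) σ^c τ − (c−1)2^{c−1} σ^{c+1})` TELESCOPES at the fixed
point (`alg2_A_step`: `Σ_j (j w^{j+1} − (j+2) w^{j+3}) = w² + O(w^{K+2})`, `w = 2Xι`, `θ = w²ι/2`).
PART IV — ★★★ `exists_polynomial_largeForceCoeffZd_leadingCoeff` / ★★★ `exists_polynomial_largeForceCoeffZd_natDegree_eq` — for every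
`k ≥ 2`, `d ↦ c_k^{(d)}` is a polynomial over `ℚ` of degree EXACTLY `k − 1` with leading coefficient `(−2)^{k−1}`: the second symbol of
`E_k = Σ_{j≤k}(1 − A_k)^j` is `−θ/ι² = −2X²ι` (`alg2_E`), whose `X^k`-coefficient is `(−2)^{k−1}`. This settles the lane's standing question
(PLAN, «is `c_k^{(d)} = (−2)^{k−1} d^{k−1} + O(d^{k−2})` for every `k`?») in full: YES, THEOREM.
[cite: MadrasSlade1993, §1.1 eq. (1.1.8) p. 5; §4.2 eq. (4.2.20)–(4.2.22)] [cite: DuminilCopinHammond2013, §2.2 (irreducible bridges)]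

Provenance: lane «pcv-sawmu», a-p1 g18 (2026-08-26), completing a-p1 g17's design `DESIGN-ZD-SECOND-SYMBOL.md`. Data (not used; the
design was validated on it first): `c₂…c₇^{(d)}` leading terms `−2d, 4d², −8d³, 16d⁴, −32d⁵, 64d⁶` (lane census and a-p3's closed forms
`c₅, c₆, c₇, c₈^{(d)}`), and the exact rational power-series check `−[x^k] T/S² = (−2)^{k−1}` for `k ≤ 8`.
-/

noncomputable section

open Finset
open scoped BigOperators
open Literature.Probability.LatticeModels
open Literature.Probability.RandomPlanarGeometry.SAW

namespace Literature.Probability.RandomPlanarGeometry.SAW.Zd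

/-! ### Second-order symbols of polynomial-in-`d` functions

Inline predicate («`f` has degree `≤ m`, top coefficient `a` and second coefficient `b`»):
`∃ P : ℚ[X], P.natDegree ≤ m ∧ P.coeff m = a ∧ (P * X).coeff m = b ∧ ∀ d : ℕ, f d = P.eval d`
(`(P * X).coeff m` is `P.coeff (m − 1)` for `m ≥ 1` and `0` for `m = 0`, so that the product rule holds without case distinction). -/

section Symbol2

/-- `[X^0]` of the reflection is the top coefficient. [cite: MadrasSlade1993, §1.1 eq. (1.1.8) p. 5; lane plumbing] -/
private theorem ss_reflect_coeff_zero (P : Polynomial ℚ) (m : ℕ) : (Polynomial.reflect m P).coeff 0 = P.coeff m := by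
  rw [Polynomial.coeff_reflect, Polynomial.revAt_le (Nat.zero_le m), Nat.sub_zero]

/-- `[X^1]` of the reflection is the second coefficient `[X^m](P · X)`. [cite: MadrasSlade1993, §1.1 eq. (1.1.8) p. 5; lane plumbing] -/
private theorem ss_reflect_coeff_one {P : Polynomial ℚ} {m : ℕ} (hP : P.natDegree ≤ m) :
    (Polynomial.reflect m P).coeff 1 = (P * Polynomial.X).coeff m := by
  rcases m with _ | m
  · rw [Polynomial.coeff_reflect, Polynomial.mul_coeff_zero, Polynomial.coeff_X_zero, mul_zero]
    have h1 : Polynomial.revAt 0 1 = 1 := by decide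
    rw [h1]
    exact Polynomial.coeff_eq_zero_of_natDegree_lt (by omega)
  · rw [Polynomial.coeff_reflect, Polynomial.revAt_le (by omega : 1 ≤ m + 1), Nat.add_sub_cancel, Polynomial.coeff_mul_X]

/-- `[X^1](p · q) = p₀ q₁ + p₁ q₀`. [cite: MadrasSlade1993, §1.1 eq. (1.1.8) p. 5; lane plumbing] -/
private theorem ss_coeff_one_mul (p q : Polynomial ℚ) : (p * q).coeff 1 = p.coeff 0 * q.coeff 1 + p.coeff 1 * q.coeff 0 := by
  rw [Polynomial.coeff_mul, Finset.Nat.sum_antidiagonal_succ, Finset.Nat.antidiagonal_zero, Finset.sum_singleton]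

/-- The second coefficient of a product: if `deg P ≤ m` and `deg Q ≤ m'` then
`[X^{m+m'}](P·Q·X) = [X^m]P · [X^{m'}](Q·X) + [X^m](P·X) · [X^{m'}]Q`. [cite: MadrasSlade1993, §1.1 eq. (1.1.8) p. 5; lane plumbing] -/
private theorem ss_coeff_mul_mul_X {P Q : Polynomial ℚ} {m m' : ℕ} (hP : P.natDegree ≤ m) (hQ : Q.natDegree ≤ m') :
    (P * Q * Polynomial.X).coeff (m + m') =
      P.coeff m * (Q * Polynomial.X).coeff m' + (P * Polynomial.X).coeff m * Q.coeff m' := by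
  have hPQ : (P * Q).natDegree ≤ m + m' := Polynomial.natDegree_mul_le.trans (add_le_add hP hQ)
  rw [← ss_reflect_coeff_one hPQ, Polynomial.reflect_mul P Q hP hQ, ss_coeff_one_mul, ss_reflect_coeff_zero,
    ss_reflect_coeff_zero, ss_reflect_coeff_one hP, ss_reflect_coeff_one hQ]

/-- Products: degrees add, symbols `(a, b)·(a', b') = (aa', ab' + ba')`. [cite: MadrasSlade1993, §1.1 eq. (1.1.8) p. 5; lane plumbing] -/
private theorem gsc2_mul {f g : ℕ → ℚ} {m m' : ℕ} {a b a' b' : ℚ}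
    (hf : ∃ P : Polynomial ℚ, P.natDegree ≤ m ∧ P.coeff m = a ∧ (P * Polynomial.X).coeff m = b ∧
      ∀ d : ℕ, f d = P.eval (d : ℚ))
    (hg : ∃ P : Polynomial ℚ, P.natDegree ≤ m' ∧ P.coeff m' = a' ∧ (P * Polynomial.X).coeff m' = b' ∧
      ∀ d : ℕ, g d = P.eval (d : ℚ)) :
    ∃ P : Polynomial ℚ, P.natDegree ≤ m + m' ∧ P.coeff (m + m') = a * a' ∧
      (P * Polynomial.X).coeff (m + m') = a * b' + b * a' ∧ ∀ d : ℕ, f d * g d = P.eval (d : ℚ) := by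
  obtain ⟨P, hP, hPa, hPb, hf⟩ := hf
  obtain ⟨Q, hQ, hQa, hQb, hg⟩ := hg
  refine ⟨P * Q, Polynomial.natDegree_mul_le.trans (add_le_add hP hQ),
    by rw [Polynomial.coeff_mul_add_eq_of_natDegree_le hP hQ, hPa, hQa],
    by rw [ss_coeff_mul_mul_X hP hQ, hPa, hPb, hQa, hQb], fun d => by rw [hf, hg, Polynomial.eval_mul]⟩

/-- Differences. [cite: MadrasSlade1993, §1.1 eq. (1.1.8) p. 5; lane plumbing] -/
private theorem gsc2_sub {f g : ℕ → ℚ} {m : ℕ} {a b a' b' : ℚ}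
    (hf : ∃ P : Polynomial ℚ, P.natDegree ≤ m ∧ P.coeff m = a ∧ (P * Polynomial.X).coeff m = b ∧
      ∀ d : ℕ, f d = P.eval (d : ℚ))
    (hg : ∃ P : Polynomial ℚ, P.natDegree ≤ m ∧ P.coeff m = a' ∧ (P * Polynomial.X).coeff m = b' ∧
      ∀ d : ℕ, g d = P.eval (d : ℚ)) :
    ∃ P : Polynomial ℚ, P.natDegree ≤ m ∧ P.coeff m = a - a' ∧ (P * Polynomial.X).coeff m = b - b' ∧
      ∀ d : ℕ, f d - g d = P.eval (d : ℚ) := by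
  obtain ⟨P, hP, hPa, hPb, hf⟩ := hf
  obtain ⟨Q, hQ, hQa, hQb, hg⟩ := hg
  exact ⟨P - Q, (Polynomial.natDegree_sub_le _ _).trans (max_le hP hQ), by rw [Polynomial.coeff_sub, hPa, hQa],
    by rw [sub_mul, Polynomial.coeff_sub, hPb, hQb], fun d => by rw [hf, hg, Polynomial.eval_sub]⟩

/-- Finite sums. [cite: MadrasSlade1993, §1.1 eq. (1.1.8) p. 5; lane plumbing] -/
private theorem gsc2_sum {ι : Type*} (s : Finset ι) {f : ι → ℕ → ℚ} {m : ℕ} {a b : ι → ℚ}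
    (h : ∀ i ∈ s, ∃ P : Polynomial ℚ, P.natDegree ≤ m ∧ P.coeff m = a i ∧ (P * Polynomial.X).coeff m = b i ∧
      ∀ d : ℕ, f i d = P.eval (d : ℚ)) :
    ∃ P : Polynomial ℚ, P.natDegree ≤ m ∧ P.coeff m = ∑ i ∈ s, a i ∧ (P * Polynomial.X).coeff m = ∑ i ∈ s, b i ∧
      ∀ d : ℕ, (∑ i ∈ s, f i d) = P.eval (d : ℚ) := by
  classical
  induction s using Finset.induction_on with
  | empty => exact ⟨0, by simp, by simp, by simp, fun d => by simp⟩
  | @insert i s hi ih =>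
    obtain ⟨P, hP, hPa, hPb, hf⟩ := h i (Finset.mem_insert_self i s)
    obtain ⟨Q, hQ, hQa, hQb, hg⟩ := ih fun j hj => h j (Finset.mem_insert_of_mem hj)
    refine ⟨P + Q, (Polynomial.natDegree_add_le _ _).trans (max_le hP hQ), ?_, ?_, fun d => ?_⟩
    · rw [Polynomial.coeff_add, hPa, hQa, Finset.sum_insert hi]
    · rw [add_mul, Polynomial.coeff_add, hPb, hQb, Finset.sum_insert hi]
    · rw [Finset.sum_insert hi, hf, hg, Polynomial.eval_add]

/-- Pointwise-equal functions. [cite: MadrasSlade1993, §1.1 eq. (1.1.8) p. 5; lane plumbing] -/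
private theorem gsc2_congr {f g : ℕ → ℚ} {m : ℕ} {a b : ℚ} (hfg : ∀ d, f d = g d)
    (h : ∃ P : Polynomial ℚ, P.natDegree ≤ m ∧ P.coeff m = a ∧ (P * Polynomial.X).coeff m = b ∧
      ∀ d : ℕ, f d = P.eval (d : ℚ)) :
    ∃ P : Polynomial ℚ, P.natDegree ≤ m ∧ P.coeff m = a ∧ (P * Polynomial.X).coeff m = b ∧
      ∀ d : ℕ, g d = P.eval (d : ℚ) := by
  obtain ⟨P, hP, hPa, hPb, hf⟩ := h
  exact ⟨P, hP, hPa, hPb, fun d => by rw [← hfg d, hf d]⟩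

/-- Equal symbol values. [cite: MadrasSlade1993, §1.1 eq. (1.1.8) p. 5; lane plumbing] -/
private theorem gsc2_of_eq {f : ℕ → ℚ} {m : ℕ} {a b a' b' : ℚ} (ha : a = a') (hb : b = b')
    (h : ∃ P : Polynomial ℚ, P.natDegree ≤ m ∧ P.coeff m = a ∧ (P * Polynomial.X).coeff m = b ∧
      ∀ d : ℕ, f d = P.eval (d : ℚ)) :
    ∃ P : Polynomial ℚ, P.natDegree ≤ m ∧ P.coeff m = a' ∧ (P * Polynomial.X).coeff m = b' ∧
      ∀ d : ℕ, f d = P.eval (d : ℚ) := by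
  subst ha hb; exact h

/-- The zero function has every degree bound with symbols `(0, 0)`. [cite: MadrasSlade1993, §1.1 eq. (1.1.8) p. 5; lane plumbing] -/
private theorem gsc2_zero (m : ℕ) :
    ∃ P : Polynomial ℚ, P.natDegree ≤ m ∧ P.coeff m = 0 ∧ (P * Polynomial.X).coeff m = 0 ∧
      ∀ d : ℕ, (0 : ℚ) = P.eval (d : ℚ) :=
  ⟨0, by simp, by simp, by simp, fun d => by simp⟩

/-- Raising a too-generous degree bound: a function of degree `≤ m` has symbols `(0, 0)` in degree `m + 2`.
[cite: MadrasSlade1993, §1.1 eq. (1.1.8) p. 5; lane plumbing] -/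
private theorem gsc2_raise_two {f : ℕ → ℚ} {m m' : ℕ} (h : ∃ P : Polynomial ℚ, P.natDegree ≤ m ∧ ∀ d : ℕ, f d = P.eval (d : ℚ))
    (hm : m + 2 ≤ m') :
    ∃ P : Polynomial ℚ, P.natDegree ≤ m' ∧ P.coeff m' = 0 ∧ (P * Polynomial.X).coeff m' = 0 ∧
      ∀ d : ℕ, f d = P.eval (d : ℚ) := by
  obtain ⟨P, hP, hf⟩ := h
  have hPX : (P * Polynomial.X).natDegree ≤ m + 1 :=
    Polynomial.natDegree_mul_le.trans (by rw [Polynomial.natDegree_X]; omega)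
  exact ⟨P, hP.trans (by omega), Polynomial.coeff_eq_zero_of_natDegree_lt (by omega),
    Polynomial.coeff_eq_zero_of_natDegree_lt (by omega), hf⟩

/-! #### Families of integer polynomials `d ↦ S_d ∈ ℤ[X]` with symbol PAIR `(σ, τ)` up to order `K`:
`[X^i] S_d` has degree `≤ i` in `d` with `d^i`-coefficient `σ.coeff i` and `d^{i−1}`-coefficient `τ.coeff i` for `i ≤ K`. -/

/-- The constant family `1` has symbol pair `(1, 0)`. [cite: MadrasSlade1993, §1.1 eq. (1.1.8) p. 5; lane plumbing] -/
private theorem gsym2_one (K : ℕ) : ∀ i ≤ K, ∃ P : Polynomial ℚ, P.natDegree ≤ i ∧ P.coeff i = (1 : Polynomial ℚ).coeff i ∧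
    (P * Polynomial.X).coeff i = (0 : Polynomial ℚ).coeff i ∧
    ∀ d : ℕ, ((((1 : Polynomial ℤ)).coeff i : ℤ) : ℚ) = P.eval (d : ℚ) := by
  intro i _
  by_cases hi : i = 0
  · subst hi
    refine ⟨1, by simp, by simp, ?_, fun d => by simp⟩
    rw [one_mul, Polynomial.coeff_X_zero, Polynomial.coeff_zero]
  · refine ⟨0, by simp, by simp [Polynomial.coeff_one, hi], by simp, fun d => by simp [Polynomial.coeff_one, hi]⟩

/-- Products of families: symbol pairs multiply as `(σ, τ)(σ', τ') = (σσ', στ' + τσ')`. [cite: MadrasSlade1993, §1.1 eq. (1.1.8) p. 5; lane plumbing] -/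
private theorem gsym2_mul {S T : ℕ → Polynomial ℤ} {σ τ σ' τ' : Polynomial ℚ} {K : ℕ}
    (hS : ∀ i ≤ K, ∃ P : Polynomial ℚ, P.natDegree ≤ i ∧ P.coeff i = σ.coeff i ∧ (P * Polynomial.X).coeff i = τ.coeff i ∧
      ∀ d : ℕ, (((S d).coeff i : ℤ) : ℚ) = P.eval (d : ℚ))
    (hT : ∀ i ≤ K, ∃ P : Polynomial ℚ, P.natDegree ≤ i ∧ P.coeff i = σ'.coeff i ∧ (P * Polynomial.X).coeff i = τ'.coeff i ∧
      ∀ d : ℕ, (((T d).coeff i : ℤ) : ℚ) = P.eval (d : ℚ)) :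
    ∀ i ≤ K, ∃ P : Polynomial ℚ, P.natDegree ≤ i ∧ P.coeff i = (σ * σ').coeff i ∧
      (P * Polynomial.X).coeff i = (σ * τ' + τ * σ').coeff i ∧
      ∀ d : ℕ, (((S d * T d).coeff i : ℤ) : ℚ) = P.eval (d : ℚ) := by
  intro i hi
  have key : ∃ P : Polynomial ℚ, P.natDegree ≤ i ∧
      P.coeff i = ∑ x ∈ antidiagonal i, σ.coeff x.1 * σ'.coeff x.2 ∧
      (P * Polynomial.X).coeff i = ∑ x ∈ antidiagonal i, (σ.coeff x.1 * τ'.coeff x.2 + τ.coeff x.1 * σ'.coeff x.2) ∧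
      ∀ d : ℕ, (∑ x ∈ antidiagonal i, (((S d).coeff x.1 : ℚ)) * ((T d).coeff x.2 : ℚ)) = P.eval (d : ℚ) := by
    refine gsc2_sum _ fun x hx => ?_
    have hx' : x.1 + x.2 = i := mem_antidiagonal.1 hx
    have h := gsc2_mul (hS x.1 (by omega)) (hT x.2 (by omega))
    rwa [hx'] at h
  obtain ⟨P, hP, hPa, hPb, h⟩ := key
  refine ⟨P, hP, by rw [hPa, Polynomial.coeff_mul], ?_, fun d => ?_⟩
  · rw [hPb, Polynomial.coeff_add, Polynomial.coeff_mul, Polynomial.coeff_mul, ← Finset.sum_add_distrib]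
  · rw [← h d, Polynomial.coeff_mul]
    push_cast
    rfl

/-- Powers of a family: symbol pair `(σ^n, n σ^{n−1} τ)`. [cite: MadrasSlade1993, §1.1 eq. (1.1.8) p. 5; lane plumbing] -/
private theorem gsym2_pow {S : ℕ → Polynomial ℤ} {σ τ : Polynomial ℚ} {K : ℕ}
    (hS : ∀ i ≤ K, ∃ P : Polynomial ℚ, P.natDegree ≤ i ∧ P.coeff i = σ.coeff i ∧ (P * Polynomial.X).coeff i = τ.coeff i ∧
      ∀ d : ℕ, (((S d).coeff i : ℤ) : ℚ) = P.eval (d : ℚ)) (n : ℕ) :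
    ∀ i ≤ K, ∃ P : Polynomial ℚ, P.natDegree ≤ i ∧ P.coeff i = (σ ^ n).coeff i ∧
      (P * Polynomial.X).coeff i = ((n : Polynomial ℚ) * σ ^ (n - 1) * τ).coeff i ∧
      ∀ d : ℕ, ((((S d) ^ n).coeff i : ℤ) : ℚ) = P.eval (d : ℚ) := by
  induction n with
  | zero =>
    intro i hi
    obtain ⟨P, hP, hPa, hPb, h⟩ := gsym2_one K i hi
    refine ⟨P, hP, by rw [hPa, pow_zero], by rw [hPb]; simp, fun d => by rw [← h d, pow_zero]⟩
  | succ n ih =>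
    intro i hi
    obtain ⟨P, hP, hPa, hPb, h⟩ := gsym2_mul (S := fun d => S d ^ n) (T := S) ih hS i hi
    have hid : σ ^ n * τ + (n : Polynomial ℚ) * σ ^ (n - 1) * τ * σ = ((n + 1 : ℕ) : Polynomial ℚ) * σ ^ (n + 1 - 1) * τ := by
      rcases n with _ | k
      · simp
      · rw [Nat.add_sub_cancel, show k + 1 + 1 - 1 = k + 1 from rfl, pow_succ]; push_cast; ring
    refine ⟨P, hP, by rw [hPa, pow_succ], by rw [hPb, hid], fun d => by rw [← h d, pow_succ]⟩

/-- Differences of families. [cite: MadrasSlade1993, §1.1 eq. (1.1.8) p. 5; lane plumbing] -/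
private theorem gsym2_sub {S T : ℕ → Polynomial ℤ} {σ τ σ' τ' : Polynomial ℚ} {K : ℕ}
    (hS : ∀ i ≤ K, ∃ P : Polynomial ℚ, P.natDegree ≤ i ∧ P.coeff i = σ.coeff i ∧ (P * Polynomial.X).coeff i = τ.coeff i ∧
      ∀ d : ℕ, (((S d).coeff i : ℤ) : ℚ) = P.eval (d : ℚ))
    (hT : ∀ i ≤ K, ∃ P : Polynomial ℚ, P.natDegree ≤ i ∧ P.coeff i = σ'.coeff i ∧ (P * Polynomial.X).coeff i = τ'.coeff i ∧
      ∀ d : ℕ, (((T d).coeff i : ℤ) : ℚ) = P.eval (d : ℚ)) :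
    ∀ i ≤ K, ∃ P : Polynomial ℚ, P.natDegree ≤ i ∧ P.coeff i = (σ - σ').coeff i ∧
      (P * Polynomial.X).coeff i = (τ - τ').coeff i ∧
      ∀ d : ℕ, (((S d - T d).coeff i : ℤ) : ℚ) = P.eval (d : ℚ) := by
  intro i hi
  obtain ⟨P, hP, hPa, hPb, h⟩ := gsc2_sub (hS i hi) (hT i hi)
  refine ⟨P, hP, by rw [hPa, Polynomial.coeff_sub], by rw [hPb, Polynomial.coeff_sub], fun d => ?_⟩
  rw [← h d, Polynomial.coeff_sub]
  push_cast
  rfl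

/-- Finite sums of families. [cite: MadrasSlade1993, §1.1 eq. (1.1.8) p. 5; lane plumbing] -/
private theorem gsym2_sum {ι : Type*} (s : Finset ι) {S : ι → ℕ → Polynomial ℤ} {σ τ : ι → Polynomial ℚ} {K : ℕ}
    (hS : ∀ j ∈ s, ∀ i ≤ K, ∃ P : Polynomial ℚ, P.natDegree ≤ i ∧ P.coeff i = (σ j).coeff i ∧
      (P * Polynomial.X).coeff i = (τ j).coeff i ∧ ∀ d : ℕ, (((S j d).coeff i : ℤ) : ℚ) = P.eval (d : ℚ)) :
    ∀ i ≤ K, ∃ P : Polynomial ℚ, P.natDegree ≤ i ∧ P.coeff i = (∑ j ∈ s, σ j).coeff i ∧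
      (P * Polynomial.X).coeff i = (∑ j ∈ s, τ j).coeff i ∧
      ∀ d : ℕ, (((∑ j ∈ s, S j d).coeff i : ℤ) : ℚ) = P.eval (d : ℚ) := by
  intro i hi
  obtain ⟨P, hP, hPa, hPb, h⟩ := gsc2_sum s (fun j hj => hS j hj i hi)
  refine ⟨P, hP, by rw [hPa, Polynomial.finsetSum_coeff], by rw [hPb, Polynomial.finsetSum_coeff], fun d => ?_⟩
  rw [← h d, Polynomial.finsetSum_coeff]
  push_cast
  rfl

end Symbol2


/-! ### The symbol pair of the cost census: `([d^c], [d^{c−1}]) N_{c,n}(ℤ^{d+1}) = (2^c, −(c−1)2^{c−1}) · [n = c+1]` -/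

section Census

/-- ★★ THE SECOND SYMBOL OF THE COST CENSUS: for `c ≥ 1`, `d ↦ N_{c,n}(ℤ^{d+1})` is a polynomial of degree `≤ c` whose `d^c`- and
`d^{c−1}`-coefficients are `2^c` and `−(c−1)·2^{c−1}` on the span-one cell `n = c + 1` (where `N_{c,c+1}(ℤ^{d+1}) = c_c(ℤ^d)`,
`costCoeffZd_self_succ`, and `SAWCountZdTopCoefficients` gives both coefficients of `c_c(ℤ^d)`) and `0`, `0` on every other cell
(`n ≤ c`: the cell is empty; `n ≥ c + 2`: degree `≤ 3c + 2 − 2n ≤ c − 2` by the degree profile).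
[cite: MadrasSlade1993, §1.1 eq. (1.1.8) p. 5; §4.2 eq. (4.2.20)–(4.2.22); lane theorem] -/
theorem exists_polynomial_costCoeffZd_topTwo {c : ℕ} (hc : 1 ≤ c) (n : ℕ) :
    ∃ P : Polynomial ℚ, P.natDegree ≤ c ∧ P.coeff c = (if n = c + 1 then (2 : ℚ) ^ c else 0) ∧
      (P * Polynomial.X).coeff c = (if n = c + 1 then -((c : ℚ) - 1) * 2 ^ (c - 1) else 0) ∧
      ∀ d : ℕ, (costCoeffZd d c n : ℚ) = P.eval (d : ℚ) := by
  by_cases hn : n = c + 1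
  · subst hn
    rw [if_pos rfl, if_pos rfl]
    obtain ⟨P, hP, ha, hb, hev⟩ := exists_polynomial_count_topTwo' hc
    exact ⟨P, hP, ha, hb, fun d => by rw [costCoeffZd_self_succ]; exact hev d⟩
  · rw [if_neg hn, if_neg hn]
    rcases Nat.lt_or_ge n (c + 1) with hlt | hge
    · -- `n ≤ c`: the cell is empty
      refine ⟨0, by simp, by simp, by simp, fun d => ?_⟩
      rw [costCoeffZd_eq_zero_of_le (by omega : n ≤ c)]; simp
    · rcases Nat.lt_or_ge c 2 with hc1 | hc2
      · -- `c = 1`, `n ≥ 3`: the cell is empty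
        refine ⟨0, by simp, by simp, by simp, fun d => ?_⟩
        rw [costCoeffZd_eq_zero_of_lt (by omega : 3 * c + 2 < 2 * n)]; simp
      · -- `c ≥ 2`, `n ≥ c + 2`: degree `≤ c − 2`
        obtain ⟨P, hP, hev⟩ := exists_polynomial_costCoeffZd_degree_profile c n
        exact gsc2_raise_two ⟨P, hP, hev⟩ (by omega)

end Census

/-! ### The symbol pairs of the approximants `A_K`: one recursion step -/

section Engine

/-- ★ One recursion step on symbol PAIRS: if the family `d ↦ A_K(N(ℤ^{d+1}))` has symbol pair `(σ, τ)` up to order `K`, then `A_{K+1}`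
has symbol pair `(1 − Σ_{c=1}^{K+1} 2^c X^c σ^{c+1}, −Σ_{c=1}^{K+1} X^c (2^c (c+1) σ^c τ − (c−1) 2^{c−1} σ^{c+1}))` up to order `K + 1`
(only the span-one cells carry the top two degrees; the second census symbol `−(c−1)2^{c−1}` enters linearly).
[cite: MadrasSlade1993, §1.1 eq. (1.1.8) p. 5; lane lemma] -/
private theorem gsym2_A_succ {K : ℕ} {σ τ : Polynomial ℚ}
    (hA : ∀ i ≤ K, ∃ P : Polynomial ℚ, P.natDegree ≤ i ∧ P.coeff i = σ.coeff i ∧ (P * Polynomial.X).coeff i = τ.coeff i ∧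
      ∀ d : ℕ, (((CostSeries.A (costCoeffZd d) K).coeff i : ℤ) : ℚ) = P.eval (d : ℚ)) :
    ∀ i ≤ K + 1, ∃ P : Polynomial ℚ, P.natDegree ≤ i ∧
      P.coeff i = (1 - ∑ j ∈ Finset.range (K + 1), Polynomial.C ((2 : ℚ) ^ (j + 1)) * Polynomial.X ^ (j + 1) * σ ^ (j + 2)).coeff i ∧
      (P * Polynomial.X).coeff i = (0 - ∑ j ∈ Finset.range (K + 1), Polynomial.X ^ (j + 1) *
        (Polynomial.C ((2 : ℚ) ^ (j + 1)) * (((j + 2 : ℕ) : Polynomial ℚ) * σ ^ (j + 1) * τ) -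
          Polynomial.C ((j : ℚ) * 2 ^ j) * σ ^ (j + 2))).coeff i ∧
      ∀ d : ℕ, (((CostSeries.A (costCoeffZd d) (K + 1)).coeff i : ℤ) : ℚ) = P.eval (d : ℚ) := by
  intro i hi
  -- each term `X^{j+1} · P_{j+1}(A_K)`
  have hterm : ∀ j ∈ Finset.range (K + 1), ∃ P : Polynomial ℚ, P.natDegree ≤ i ∧
      P.coeff i = (Polynomial.C ((2 : ℚ) ^ (j + 1)) * Polynomial.X ^ (j + 1) * σ ^ (j + 2)).coeff i ∧
      (P * Polynomial.X).coeff i = (Polynomial.X ^ (j + 1) *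
        (Polynomial.C ((2 : ℚ) ^ (j + 1)) * (((j + 2 : ℕ) : Polynomial ℚ) * σ ^ (j + 1) * τ) -
          Polynomial.C ((j : ℚ) * 2 ^ j) * σ ^ (j + 2))).coeff i ∧ ∀ d : ℕ,
      (((Polynomial.X ^ (j + 1) * (CostSeries.Pz (costCoeffZd d) (j + 1)).comp (CostSeries.A (costCoeffZd d) K)).coeff i : ℤ) : ℚ) =
        P.eval (d : ℚ) := by
    intro j _
    have hcoef : (Polynomial.C ((2 : ℚ) ^ (j + 1)) * Polynomial.X ^ (j + 1) * σ ^ (j + 2)).coeff i =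
        if j + 1 ≤ i then (2 : ℚ) ^ (j + 1) * (σ ^ (j + 2)).coeff (i - (j + 1)) else 0 := by
      rw [mul_assoc, Polynomial.coeff_C_mul, Polynomial.coeff_X_pow_mul']
      split_ifs <;> simp
    have hcoef2 : (Polynomial.X ^ (j + 1) * (Polynomial.C ((2 : ℚ) ^ (j + 1)) * (((j + 2 : ℕ) : Polynomial ℚ) * σ ^ (j + 1) * τ) -
          Polynomial.C ((j : ℚ) * 2 ^ j) * σ ^ (j + 2))).coeff i =
        if j + 1 ≤ i then (2 : ℚ) ^ (j + 1) * ((((j + 2 : ℕ) : Polynomial ℚ) * σ ^ (j + 1) * τ)).coeff (i - (j + 1)) -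
          ((j : ℚ) * 2 ^ j) * (σ ^ (j + 2)).coeff (i - (j + 1)) else 0 := by
      rw [Polynomial.coeff_X_pow_mul']
      split_ifs
      · rw [Polynomial.coeff_sub, Polynomial.coeff_C_mul, Polynomial.coeff_C_mul]
      · rfl
    by_cases hji : j + 1 ≤ i
    · -- `[X^{i-(j+1)}] P_{j+1}(A_K) = Σ_n N_{j+1,n} · [X^{i-(j+1)}] A_K^n`
      have hsum : ∃ P : Polynomial ℚ, P.natDegree ≤ i ∧
          P.coeff i = ∑ n ∈ Finset.range (2 * (j + 1) + 2),
            (if n = (j + 1) + 1 then (2 : ℚ) ^ (j + 1) else 0) * (σ ^ n).coeff (i - (j + 1)) ∧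
          (P * Polynomial.X).coeff i = ∑ n ∈ Finset.range (2 * (j + 1) + 2),
            ((if n = (j + 1) + 1 then (2 : ℚ) ^ (j + 1) else 0) * (((n : Polynomial ℚ) * σ ^ (n - 1) * τ)).coeff (i - (j + 1)) +
              (if n = (j + 1) + 1 then -(((j + 1 : ℕ) : ℚ) - 1) * 2 ^ (j + 1 - 1) else 0) * (σ ^ n).coeff (i - (j + 1))) ∧ ∀ d : ℕ,
          (∑ n ∈ Finset.range (2 * (j + 1) + 2),
            (costCoeffZd d (j + 1) n : ℚ) * (((CostSeries.A (costCoeffZd d) K ^ n).coeff (i - (j + 1)) : ℤ) : ℚ)) =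
            P.eval (d : ℚ) := by
        refine gsc2_sum _ fun n _ => ?_
        have h := gsc2_mul (exists_polynomial_costCoeffZd_topTwo (Nat.succ_pos j) n)
          (gsym2_pow hA n (i - (j + 1)) (by omega))
        rwa [show j + 1 + (i - (j + 1)) = i by omega] at h
      obtain ⟨P, hP, hPa, hPb, h⟩ := hsum
      refine ⟨P, hP, ?_, ?_, fun d => ?_⟩
      · rw [hPa, hcoef, if_pos hji, Finset.sum_eq_single_of_mem ((j + 1) + 1)
          (Finset.mem_range.2 (by omega)) (fun n _ hn => by rw [if_neg hn, zero_mul]), if_pos rfl]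
      · rw [hPb, hcoef2, if_pos hji, Finset.sum_eq_single_of_mem ((j + 1) + 1)
          (Finset.mem_range.2 (by omega)) (fun n _ hn => by rw [if_neg hn, if_neg hn, zero_mul, zero_mul, add_zero]),
          if_pos rfl, if_pos rfl, Nat.add_sub_cancel, Nat.add_sub_cancel, show j + 1 + 1 = j + 2 from rfl]
        push_cast
        ring
      · rw [Polynomial.coeff_X_pow_mul', if_pos hji, ← h d, CostSeries.Pz, Polynomial.sum_comp, Polynomial.finsetSum_coeff]
        push_cast
        refine Finset.sum_congr rfl fun n _ => ?_
        rw [Polynomial.mul_comp, Polynomial.C_comp, Polynomial.X_pow_comp, Polynomial.coeff_C_mul]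
        push_cast
        rfl
    · refine ⟨0, by simp, by rw [hcoef, if_neg hji]; simp, by rw [hcoef2, if_neg hji]; simp, fun d => ?_⟩
      rw [Polynomial.coeff_X_pow_mul', if_neg hji]
      simp
  have hsum := gsc2_sum (Finset.range (K + 1)) hterm
  obtain ⟨P, hP, hPa, hPb, h⟩ := gsc2_sub ((gsym2_one (K + 1)) i hi) hsum
  refine ⟨P, hP, ?_, ?_, fun d => ?_⟩
  · rw [hPa, Polynomial.coeff_sub, Polynomial.finsetSum_coeff]
  · rw [hPb, Polynomial.coeff_sub, Polynomial.finsetSum_coeff]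
  · rw [← h d, CostSeries.A, Polynomial.coeff_sub, Polynomial.finsetSum_coeff]
    push_cast
    rfl

end Engine

/-! ### The symbol recursion solved at second order in `ℚ⟦X⟧`

With `ι := Σ_i (−2)^i X^i = (1 + 2X)⁻¹`, `w := 1 − ι = 2X·ι` and `θ := 2X²ι³`: the top symbols converge to `ι` (as in
`SAWPulledLargeForceExpansionZdTopSymbol`) and the second symbols to `θ`. -/

section Algebra

/-- `(1 + 2X) · Σ_i (−2)^i X^i = 1` in `ℚ⟦X⟧`. [cite: MadrasSlade1993, §1.1 eq. (1.1.8) p. 5; lane plumbing] -/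
private theorem alg2_iota_mul :
    (1 + PowerSeries.C (2 : ℚ) * PowerSeries.X) * PowerSeries.mk (fun i : ℕ => (-2 : ℚ) ^ i) = 1 := by
  ext n
  rw [add_mul, one_mul, map_add, PowerSeries.coeff_mk, mul_assoc, PowerSeries.coeff_C_mul, PowerSeries.coeff_one]
  rcases n with _ | n
  · rw [PowerSeries.coeff_zero_X_mul, mul_zero, add_zero, pow_zero, if_pos rfl]
  · rw [PowerSeries.coeff_succ_X_mul, PowerSeries.coeff_mk, if_neg (Nat.succ_ne_zero n), pow_succ]
    ring

/-- A telescoping sum: `Σ_{j ≤ K} (j w^{j+1} − (j+2) w^{j+3}) = w² − (K+1) w^{K+2} − (K+2) w^{K+3}`.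
[cite: MadrasSlade1993, §1.1 eq. (1.1.8) p. 5; lane plumbing] -/
private theorem alg2_telescope (w : PowerSeries ℚ) (K : ℕ) :
    ∑ j ∈ Finset.range (K + 1), (((j : ℕ) : PowerSeries ℚ) * w ^ (j + 1) - ((j + 2 : ℕ) : PowerSeries ℚ) * w ^ (j + 3)) =
      w ^ 2 - ((K + 1 : ℕ) : PowerSeries ℚ) * w ^ (K + 2) - ((K + 2 : ℕ) : PowerSeries ℚ) * w ^ (K + 3) := by
  induction K with
  | zero => rw [Finset.sum_range_one]; push_cast; ring
  | succ K ih => rw [Finset.sum_range_succ, ih]; push_cast; ring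

/-- The second geometric identity: `(1 − w)² Σ_{m < k} (m+1) w^m = 1 − (k+1) w^k + k w^{k+1}`.
[cite: MadrasSlade1993, §1.1 eq. (1.1.8) p. 5; lane plumbing] -/
private theorem alg2_geom2 (w : PowerSeries ℚ) (k : ℕ) :
    (1 - w) ^ 2 * ∑ m ∈ Finset.range k, ((m + 1 : ℕ) : PowerSeries ℚ) * w ^ m =
      1 - ((k + 1 : ℕ) : PowerSeries ℚ) * w ^ k + ((k : ℕ) : PowerSeries ℚ) * w ^ (k + 1) := by
  induction k with
  | zero => rw [Finset.sum_range_zero]; push_cast; ring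
  | succ k ih => rw [Finset.sum_range_succ, mul_add, ih]; push_cast; ring

/-- In `ℚ⟦X⟧`, `X^n ∣ 2·f` implies `X^n ∣ f`. [cite: MadrasSlade1993, §1.1 eq. (1.1.8) p. 5; lane plumbing] -/
private theorem alg2_dvd_of_dvd_two_mul {n : ℕ} {f : PowerSeries ℚ}
    (h : (PowerSeries.X : PowerSeries ℚ) ^ n ∣ PowerSeries.C (2 : ℚ) * f) :
    (PowerSeries.X : PowerSeries ℚ) ^ n ∣ f := by
  have : f = PowerSeries.C (1 / 2 : ℚ) * (PowerSeries.C (2 : ℚ) * f) := by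
    rw [← mul_assoc, ← map_mul]; norm_num
  rw [this]
  exact dvd_mul_of_dvd_right h _

/-- In `ℚ⟦X⟧`, `X^n ∣ ι²·f` implies `X^n ∣ f` (`ι` is a unit: `(1+2X) ι = 1`). [cite: MadrasSlade1993, §1.1 eq. (1.1.8) p. 5; lane plumbing] -/
private theorem alg2_dvd_of_dvd_iota_sq_mul {n : ℕ} {f : PowerSeries ℚ}
    (h : (PowerSeries.X : PowerSeries ℚ) ^ n ∣ PowerSeries.mk (fun i : ℕ => (-2 : ℚ) ^ i) ^ 2 * f) :
    (PowerSeries.X : PowerSeries ℚ) ^ n ∣ f := by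
  have hF1 := alg2_iota_mul
  have : f = (1 + PowerSeries.C (2 : ℚ) * PowerSeries.X) ^ 2 * (PowerSeries.mk (fun i : ℕ => (-2 : ℚ) ^ i) ^ 2 * f) := by
    calc f = ((1 + PowerSeries.C (2 : ℚ) * PowerSeries.X) * PowerSeries.mk (fun i : ℕ => (-2 : ℚ) ^ i)) ^ 2 * f := by
          rw [hF1, one_pow, one_mul]
      _ = _ := by ring
  rw [this]
  exact dvd_mul_of_dvd_right h _

/-- ★ THE SYMBOL-PAIR RECURSION PRESERVES `(ι, θ)`: if `σ ≡ ι` and `τ ≡ θ (mod X^{K+1})` then the recursion outputs satisfy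
`1 − Σ_{c≤K+1} 2^c X^c σ^{c+1} ≡ ι` and `−Σ_{c≤K+1} X^c (2^c (c+1) σ^c τ − (c−1)2^{c−1} σ^{c+1}) ≡ θ (mod X^{K+2})`, where
`θ = 2X²ι³` — at second order in `1/d` the fixed point of the cost series is `U = ι + θ/d + O(d⁻²)` in the scaled variable.
(The second identity telescopes: `Σ_j (j w^{j+1} − (j+2) w^{j+3}) = w² + O(w^{K+2})` with `w = 2Xι`, `θ = w²ι/2`.)
[cite: MadrasSlade1993, §1.1 eq. (1.1.8) p. 5; lane lemma] -/
private theorem alg2_A_step {K : ℕ} {σ τ : Polynomial ℚ}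
    (hσ : (PowerSeries.X : PowerSeries ℚ) ^ (K + 1) ∣ ((σ : PowerSeries ℚ) - PowerSeries.mk (fun i : ℕ => (-2 : ℚ) ^ i)))
    (hτ : (PowerSeries.X : PowerSeries ℚ) ^ (K + 1) ∣ ((τ : PowerSeries ℚ) -
      PowerSeries.C (2 : ℚ) * PowerSeries.X ^ 2 * PowerSeries.mk (fun i : ℕ => (-2 : ℚ) ^ i) ^ 3)) :
    (PowerSeries.X : PowerSeries ℚ) ^ (K + 2) ∣
      ((((1 - ∑ j ∈ Finset.range (K + 1), Polynomial.C ((2 : ℚ) ^ (j + 1)) * Polynomial.X ^ (j + 1) * σ ^ (j + 2) :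
        Polynomial ℚ)) : PowerSeries ℚ) - PowerSeries.mk (fun i : ℕ => (-2 : ℚ) ^ i)) ∧
    (PowerSeries.X : PowerSeries ℚ) ^ (K + 2) ∣
      ((((0 - ∑ j ∈ Finset.range (K + 1), Polynomial.X ^ (j + 1) *
        (Polynomial.C ((2 : ℚ) ^ (j + 1)) * (((j + 2 : ℕ) : Polynomial ℚ) * σ ^ (j + 1) * τ) -
          Polynomial.C ((j : ℚ) * 2 ^ j) * σ ^ (j + 2)) : Polynomial ℚ)) : PowerSeries ℚ) -
        PowerSeries.C (2 : ℚ) * PowerSeries.X ^ 2 * PowerSeries.mk (fun i : ℕ => (-2 : ℚ) ^ i) ^ 3) := by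
  set ι : PowerSeries ℚ := PowerSeries.mk (fun i : ℕ => (-2 : ℚ) ^ i) with hι
  set w : PowerSeries ℚ := 1 - ι with hw
  set θ : PowerSeries ℚ := PowerSeries.C (2 : ℚ) * PowerSeries.X ^ 2 * ι ^ 3 with hθ
  have hF1 : (1 + PowerSeries.C (2 : ℚ) * PowerSeries.X) * ι = 1 := alg2_iota_mul
  have hw2 : PowerSeries.C (2 : ℚ) * PowerSeries.X * ι = w := by
    rw [hw]; linear_combination hF1
  have hwX : (PowerSeries.X : PowerSeries ℚ) ∣ w := by
    rw [← hw2]; exact Dvd.intro_left (PowerSeries.C (2 : ℚ) * ι) (by ring)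
  have hwpow : ∀ j : ℕ, PowerSeries.C ((2 : ℚ) ^ (j + 1)) * PowerSeries.X ^ (j + 1) * ι ^ (j + 1) = w ^ (j + 1) := by
    intro j
    rw [← hw2, map_pow]; ring
  have hθw : PowerSeries.C (2 : ℚ) * θ = w ^ 2 * ι := by
    rw [hθ, ← hw2]; ring
  -- casts of σ-powers and τ are congruent to ι-powers and θ
  have hσpow : ∀ m : ℕ, (PowerSeries.X : PowerSeries ℚ) ^ (K + 1) ∣ (σ : PowerSeries ℚ) ^ m - ι ^ m := fun m =>
    hσ.trans (sub_dvd_pow_sub_pow _ _ m)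
  have hστ : ∀ m : ℕ, (PowerSeries.X : PowerSeries ℚ) ^ (K + 1) ∣ (σ : PowerSeries ℚ) ^ m * (τ : PowerSeries ℚ) - ι ^ m * θ := by
    intro m
    have : (σ : PowerSeries ℚ) ^ m * (τ : PowerSeries ℚ) - ι ^ m * θ =
        (σ : PowerSeries ℚ) ^ m * ((τ : PowerSeries ℚ) - θ) + ((σ : PowerSeries ℚ) ^ m - ι ^ m) * θ := by ring
    rw [this]
    exact dvd_add (dvd_mul_of_dvd_right hτ _) (dvd_mul_of_dvd_left (hσpow m) _)
  have hshift : ∀ j : ℕ, ∀ g : PowerSeries ℚ, (PowerSeries.X : PowerSeries ℚ) ^ (K + 1) ∣ g →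
      (PowerSeries.X : PowerSeries ℚ) ^ (K + 2) ∣ PowerSeries.X ^ (j + 1) * g := by
    intro j g hg
    rw [show K + 2 = 1 + (K + 1) by ring, pow_add, pow_one]
    exact mul_dvd_mul (dvd_pow_self _ (Nat.succ_ne_zero j)) hg
  constructor
  · -- TOP: `1 − Σ_j 2^{j+1} X^{j+1} ι^{j+2} = 1 − w(1 − w^{K+1}) = ι + w^{K+2}`
    have hQ : (((1 - ∑ j ∈ Finset.range (K + 1), Polynomial.C ((2 : ℚ) ^ (j + 1)) * Polynomial.X ^ (j + 1) * σ ^ (j + 2) :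
        Polynomial ℚ)) : PowerSeries ℚ) =
        1 - ∑ j ∈ Finset.range (K + 1), PowerSeries.C ((2 : ℚ) ^ (j + 1)) * PowerSeries.X ^ (j + 1) * (σ : PowerSeries ℚ) ^ (j + 2) := by
      rw [← Polynomial.coeToPowerSeries.ringHom_apply, map_sub, map_one, map_sum]
      refine congrArg _ (Finset.sum_congr rfl fun j _ => ?_)
      simp only [map_mul, map_pow, Polynomial.coeToPowerSeries.ringHom_apply, Polynomial.coe_C, Polynomial.coe_X]
    have hmodel : ∑ j ∈ Finset.range (K + 1), PowerSeries.C ((2 : ℚ) ^ (j + 1)) * PowerSeries.X ^ (j + 1) * ι ^ (j + 2)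
        = w - w ^ (K + 2) := by
      have hterm : ∀ j, PowerSeries.C ((2 : ℚ) ^ (j + 1)) * PowerSeries.X ^ (j + 1) * ι ^ (j + 2) = ι * w * w ^ j := by
        intro j
        rw [pow_succ ι (j + 1), ← mul_assoc, hwpow j]; ring
      rw [Finset.sum_congr rfl (fun j _ => hterm j), ← Finset.mul_sum]
      have hι1 : ι * ∑ j ∈ Finset.range (K + 1), w ^ j = 1 - w ^ (K + 1) := by
        rw [show ι = 1 - w by rw [hw]; ring]; exact mul_neg_geom_sum w (K + 1)
      calc ι * w * ∑ j ∈ Finset.range (K + 1), w ^ j = w * (ι * ∑ j ∈ Finset.range (K + 1), w ^ j) := by ring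
        _ = w * (1 - w ^ (K + 1)) := by rw [hι1]
        _ = w - w ^ (K + 2) := by ring
    rw [hQ]
    have hsplit : (1 - ∑ j ∈ Finset.range (K + 1), PowerSeries.C ((2 : ℚ) ^ (j + 1)) * PowerSeries.X ^ (j + 1) *
        (σ : PowerSeries ℚ) ^ (j + 2)) - ι =
        w ^ (K + 2) - ∑ j ∈ Finset.range (K + 1), PowerSeries.X ^ (j + 1) * (PowerSeries.C ((2 : ℚ) ^ (j + 1)) *
          ((σ : PowerSeries ℚ) ^ (j + 2) - ι ^ (j + 2))) := by
      have : ∑ j ∈ Finset.range (K + 1), PowerSeries.X ^ (j + 1) * (PowerSeries.C ((2 : ℚ) ^ (j + 1)) *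
          ((σ : PowerSeries ℚ) ^ (j + 2) - ι ^ (j + 2))) =
          ∑ j ∈ Finset.range (K + 1), PowerSeries.C ((2 : ℚ) ^ (j + 1)) * PowerSeries.X ^ (j + 1) * (σ : PowerSeries ℚ) ^ (j + 2)
          - ∑ j ∈ Finset.range (K + 1), PowerSeries.C ((2 : ℚ) ^ (j + 1)) * PowerSeries.X ^ (j + 1) * ι ^ (j + 2) := by
        rw [← Finset.sum_sub_distrib]
        exact Finset.sum_congr rfl fun j _ => by ring
      rw [this, hmodel, hw]; ring
    rw [hsplit]
    exact dvd_sub (pow_dvd_pow_of_dvd hwX _)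
      (Finset.dvd_sum fun j _ => hshift j _ (dvd_mul_of_dvd_right (hσpow (j + 2)) _))
  · -- SECOND: `2·model = ι Σ_j (j w^{j+1} − (j+2) w^{j+3}) = 2θ − ι((K+1)w^{K+2} + (K+2)w^{K+3})`
    have hQ : (((0 - ∑ j ∈ Finset.range (K + 1), Polynomial.X ^ (j + 1) *
        (Polynomial.C ((2 : ℚ) ^ (j + 1)) * (((j + 2 : ℕ) : Polynomial ℚ) * σ ^ (j + 1) * τ) -
          Polynomial.C ((j : ℚ) * 2 ^ j) * σ ^ (j + 2)) : Polynomial ℚ)) : PowerSeries ℚ) =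
        0 - ∑ j ∈ Finset.range (K + 1), PowerSeries.X ^ (j + 1) *
          (PowerSeries.C ((2 : ℚ) ^ (j + 1)) * (((j + 2 : ℕ) : PowerSeries ℚ) * (σ : PowerSeries ℚ) ^ (j + 1) * (τ : PowerSeries ℚ)) -
            PowerSeries.C ((j : ℚ) * 2 ^ j) * (σ : PowerSeries ℚ) ^ (j + 2)) := by
      rw [← Polynomial.coeToPowerSeries.ringHom_apply, map_sub, map_zero, map_sum]
      refine congrArg _ (Finset.sum_congr rfl fun j _ => ?_)
      simp only [map_mul, map_pow, map_sub, map_natCast, Polynomial.coeToPowerSeries.ringHom_apply, Polynomial.coe_C,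
        Polynomial.coe_X]
    -- the model sum (with ι, θ in place of σ, τ)
    have hmodel : PowerSeries.C (2 : ℚ) * (0 - ∑ j ∈ Finset.range (K + 1), PowerSeries.X ^ (j + 1) *
        (PowerSeries.C ((2 : ℚ) ^ (j + 1)) * (((j + 2 : ℕ) : PowerSeries ℚ) * ι ^ (j + 1) * θ) -
          PowerSeries.C ((j : ℚ) * 2 ^ j) * ι ^ (j + 2))) =
        PowerSeries.C (2 : ℚ) * θ -
          ι * (((K + 1 : ℕ) : PowerSeries ℚ) * w ^ (K + 2) + ((K + 2 : ℕ) : PowerSeries ℚ) * w ^ (K + 3)) := by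
      have hterm : ∀ j : ℕ, PowerSeries.C (2 : ℚ) * (PowerSeries.X ^ (j + 1) *
          (PowerSeries.C ((2 : ℚ) ^ (j + 1)) * (((j + 2 : ℕ) : PowerSeries ℚ) * ι ^ (j + 1) * θ) -
            PowerSeries.C ((j : ℚ) * 2 ^ j) * ι ^ (j + 2))) =
          -(ι * (((j : ℕ) : PowerSeries ℚ) * w ^ (j + 1) - ((j + 2 : ℕ) : PowerSeries ℚ) * w ^ (j + 3))) := by
        intro j
        have h1 : PowerSeries.X ^ (j + 1) * PowerSeries.C ((2 : ℚ) ^ (j + 1)) * ι ^ (j + 1) = w ^ (j + 1) := by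
          rw [← hwpow j]; ring
        have h2 : PowerSeries.C (2 : ℚ) * (PowerSeries.X ^ (j + 1) * PowerSeries.C ((j : ℚ) * 2 ^ j) * ι ^ (j + 2)) =
            ((j : ℕ) : PowerSeries ℚ) * w ^ (j + 1) * ι := by
          rw [← hwpow j, map_mul, pow_succ (2 : ℚ) j, map_mul, pow_succ ι (j + 1), map_natCast]
          ring
        linear_combination (((j + 2 : ℕ) : PowerSeries ℚ) * θ * PowerSeries.C (2 : ℚ)) * h1 - h2 +
          (((j + 2 : ℕ) : PowerSeries ℚ) * w ^ (j + 1)) * hθw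
      rw [mul_sub, mul_zero, zero_sub, Finset.mul_sum, Finset.sum_congr rfl (fun j _ => hterm j), Finset.sum_neg_distrib,
        ← Finset.mul_sum, alg2_telescope w K]
      linear_combination (-1 : PowerSeries ℚ) * hθw
    rw [hQ]
    apply alg2_dvd_of_dvd_two_mul
    -- `2·(cast − θ) = 2·(cast − model) + (2·model − 2θ)`
    have hsplit : PowerSeries.C (2 : ℚ) * ((0 - ∑ j ∈ Finset.range (K + 1), PowerSeries.X ^ (j + 1) *
        (PowerSeries.C ((2 : ℚ) ^ (j + 1)) * (((j + 2 : ℕ) : PowerSeries ℚ) * (σ : PowerSeries ℚ) ^ (j + 1) * (τ : PowerSeries ℚ)) -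
          PowerSeries.C ((j : ℚ) * 2 ^ j) * (σ : PowerSeries ℚ) ^ (j + 2))) - θ) =
        -(PowerSeries.C (2 : ℚ) * ∑ j ∈ Finset.range (K + 1), PowerSeries.X ^ (j + 1) *
          (PowerSeries.C ((2 : ℚ) ^ (j + 1)) * (((j + 2 : ℕ) : PowerSeries ℚ) *
            ((σ : PowerSeries ℚ) ^ (j + 1) * (τ : PowerSeries ℚ) - ι ^ (j + 1) * θ)) -
            PowerSeries.C ((j : ℚ) * 2 ^ j) * ((σ : PowerSeries ℚ) ^ (j + 2) - ι ^ (j + 2)))) +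
        (PowerSeries.C (2 : ℚ) * (0 - ∑ j ∈ Finset.range (K + 1), PowerSeries.X ^ (j + 1) *
          (PowerSeries.C ((2 : ℚ) ^ (j + 1)) * (((j + 2 : ℕ) : PowerSeries ℚ) * ι ^ (j + 1) * θ) -
            PowerSeries.C ((j : ℚ) * 2 ^ j) * ι ^ (j + 2))) - PowerSeries.C (2 : ℚ) * θ) := by
      have : ∑ j ∈ Finset.range (K + 1), PowerSeries.X ^ (j + 1) *
          (PowerSeries.C ((2 : ℚ) ^ (j + 1)) * (((j + 2 : ℕ) : PowerSeries ℚ) *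
            ((σ : PowerSeries ℚ) ^ (j + 1) * (τ : PowerSeries ℚ) - ι ^ (j + 1) * θ)) -
            PowerSeries.C ((j : ℚ) * 2 ^ j) * ((σ : PowerSeries ℚ) ^ (j + 2) - ι ^ (j + 2))) =
          ∑ j ∈ Finset.range (K + 1), PowerSeries.X ^ (j + 1) *
            (PowerSeries.C ((2 : ℚ) ^ (j + 1)) * (((j + 2 : ℕ) : PowerSeries ℚ) * (σ : PowerSeries ℚ) ^ (j + 1) * (τ : PowerSeries ℚ)) -
              PowerSeries.C ((j : ℚ) * 2 ^ j) * (σ : PowerSeries ℚ) ^ (j + 2)) -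
          ∑ j ∈ Finset.range (K + 1), PowerSeries.X ^ (j + 1) *
            (PowerSeries.C ((2 : ℚ) ^ (j + 1)) * (((j + 2 : ℕ) : PowerSeries ℚ) * ι ^ (j + 1) * θ) -
              PowerSeries.C ((j : ℚ) * 2 ^ j) * ι ^ (j + 2)) := by
        rw [← Finset.sum_sub_distrib]
        exact Finset.sum_congr rfl fun j _ => by ring
      rw [this]; ring
    rw [hsplit, hmodel]
    refine dvd_add ?_ ?_
    · refine (Finset.dvd_sum fun j _ => hshift j _ ?_).mul_left (PowerSeries.C (2 : ℚ)) |>.neg_right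
      exact dvd_sub (dvd_mul_of_dvd_right (dvd_mul_of_dvd_right (hστ (j + 1)) _) _)
        (dvd_mul_of_dvd_right (hσpow (j + 2)) _)
    · have : PowerSeries.C (2 : ℚ) * θ -
          ι * (((K + 1 : ℕ) : PowerSeries ℚ) * w ^ (K + 2) + ((K + 2 : ℕ) : PowerSeries ℚ) * w ^ (K + 3)) -
          PowerSeries.C (2 : ℚ) * θ =
          -(ι * (((K + 1 : ℕ) : PowerSeries ℚ) + ((K + 2 : ℕ) : PowerSeries ℚ) * w)) * w ^ (K + 2) := by ring
      rw [this]
      exact dvd_mul_of_dvd_right (pow_dvd_pow_of_dvd hwX _) _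

/-- ★ THE SECOND SYMBOL OF THE INVERSE SERIES: if `σ ≡ ι` and `τ ≡ θ (mod X^{k+1})` then the second symbol polynomial of
`E_k = Σ_{j ≤ k} (1 − A_k)^j`, namely `Σ_{j ≤ k} j (1−σ)^{j−1} · (−τ)`, has `X^k`-coefficient `(−2)^{k−1}` for `k ≥ 2`:
modulo `X^{k+1}` it is `−θ Σ_{m<k} (m+1) w^m ≡ −θ/ι² = −2X²ι`. [cite: MadrasSlade1993, §1.1 eq. (1.1.8) p. 5; lane lemma] -/
private theorem alg2_E {k : ℕ} {σ τ : Polynomial ℚ} (hk : 2 ≤ k)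
    (hσ : (PowerSeries.X : PowerSeries ℚ) ^ (k + 1) ∣ ((σ : PowerSeries ℚ) - PowerSeries.mk (fun i : ℕ => (-2 : ℚ) ^ i)))
    (hτ : (PowerSeries.X : PowerSeries ℚ) ^ (k + 1) ∣ ((τ : PowerSeries ℚ) -
      PowerSeries.C (2 : ℚ) * PowerSeries.X ^ 2 * PowerSeries.mk (fun i : ℕ => (-2 : ℚ) ^ i) ^ 3)) :
    (∑ j ∈ Finset.range (k + 1), (j : Polynomial ℚ) * (1 - σ) ^ (j - 1) * (0 - τ)).coeff k = (-2 : ℚ) ^ (k - 1) := by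
  set ι : PowerSeries ℚ := PowerSeries.mk (fun i : ℕ => (-2 : ℚ) ^ i) with hι
  set w : PowerSeries ℚ := 1 - ι with hw
  set θ : PowerSeries ℚ := PowerSeries.C (2 : ℚ) * PowerSeries.X ^ 2 * ι ^ 3 with hθ
  have hF1 : (1 + PowerSeries.C (2 : ℚ) * PowerSeries.X) * ι = 1 := alg2_iota_mul
  have hw2 : PowerSeries.C (2 : ℚ) * PowerSeries.X * ι = w := by
    rw [hw]; linear_combination hF1
  have hwX : (PowerSeries.X : PowerSeries ℚ) ∣ w := by
    rw [← hw2]; exact Dvd.intro_left (PowerSeries.C (2 : ℚ) * ι) (by ring)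
  -- `1 − σ ≡ w` and its powers
  have h1σ : (PowerSeries.X : PowerSeries ℚ) ^ (k + 1) ∣ (1 - (σ : PowerSeries ℚ)) - w := by
    have : (1 - (σ : PowerSeries ℚ)) - w = -((σ : PowerSeries ℚ) - ι) := by rw [hw]; ring
    rw [this]; exact (dvd_neg.2 hσ)
  have h1σpow : ∀ m : ℕ, (PowerSeries.X : PowerSeries ℚ) ^ (k + 1) ∣ (1 - (σ : PowerSeries ℚ)) ^ m - w ^ m := fun m =>
    h1σ.trans (sub_dvd_pow_sub_pow _ _ m)
  -- the polynomial, mapped to power series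
  have hQ : (((∑ j ∈ Finset.range (k + 1), (j : Polynomial ℚ) * (1 - σ) ^ (j - 1) * (0 - τ) : Polynomial ℚ)) : PowerSeries ℚ) =
      ∑ j ∈ Finset.range (k + 1), ((j : ℕ) : PowerSeries ℚ) * (1 - (σ : PowerSeries ℚ)) ^ (j - 1) * (0 - (τ : PowerSeries ℚ)) := by
    rw [← Polynomial.coeToPowerSeries.ringHom_apply, map_sum]
    refine Finset.sum_congr rfl fun j _ => ?_
    simp only [map_mul, map_pow, map_sub, map_one, map_zero, map_natCast, Polynomial.coeToPowerSeries.ringHom_apply]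
  -- the model sum
  have hmodel : ∑ j ∈ Finset.range (k + 1), ((j : ℕ) : PowerSeries ℚ) * w ^ (j - 1) * (0 - θ) =
      -(θ * ∑ m ∈ Finset.range k, ((m + 1 : ℕ) : PowerSeries ℚ) * w ^ m) := by
    rw [Finset.sum_range_succ' (fun j => ((j : ℕ) : PowerSeries ℚ) * w ^ (j - 1) * (0 - θ)) k]
    simp only [Nat.cast_zero, zero_mul, add_zero, Nat.add_sub_cancel, Finset.mul_sum]
    rw [← Finset.sum_neg_distrib]
    exact Finset.sum_congr rfl fun m _ => by ring
  -- congruence of the actual sum with the model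
  have hdiff1 : (PowerSeries.X : PowerSeries ℚ) ^ (k + 1) ∣
      (∑ j ∈ Finset.range (k + 1), ((j : ℕ) : PowerSeries ℚ) * (1 - (σ : PowerSeries ℚ)) ^ (j - 1) * (0 - (τ : PowerSeries ℚ))) -
        ∑ j ∈ Finset.range (k + 1), ((j : ℕ) : PowerSeries ℚ) * w ^ (j - 1) * (0 - θ) := by
    rw [← Finset.sum_sub_distrib]
    refine Finset.dvd_sum fun j _ => ?_
    have : ((j : ℕ) : PowerSeries ℚ) * (1 - (σ : PowerSeries ℚ)) ^ (j - 1) * (0 - (τ : PowerSeries ℚ)) -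
        ((j : ℕ) : PowerSeries ℚ) * w ^ (j - 1) * (0 - θ) =
        -(((j : ℕ) : PowerSeries ℚ) * ((1 - (σ : PowerSeries ℚ)) ^ (j - 1) * ((τ : PowerSeries ℚ) - θ) +
          ((1 - (σ : PowerSeries ℚ)) ^ (j - 1) - w ^ (j - 1)) * θ)) := by ring
    rw [this]
    exact dvd_neg.2 (dvd_mul_of_dvd_right (dvd_add (dvd_mul_of_dvd_right hτ _) (dvd_mul_of_dvd_left (h1σpow _) _)) _)
  -- `ι² · model ≡ −θ ≡ ι² · (−2X²ι)`
  have hdiff2 : (PowerSeries.X : PowerSeries ℚ) ^ (k + 1) ∣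
      (∑ j ∈ Finset.range (k + 1), ((j : ℕ) : PowerSeries ℚ) * w ^ (j - 1) * (0 - θ)) -
        (-(PowerSeries.C (2 : ℚ) * PowerSeries.X ^ 2 * ι)) := by
    apply alg2_dvd_of_dvd_iota_sq_mul
    rw [hmodel]
    have hgeom := alg2_geom2 w k
    rw [show (1 : PowerSeries ℚ) - w = ι by rw [hw]; ring] at hgeom
    have : ι ^ 2 * (-(θ * ∑ m ∈ Finset.range k, ((m + 1 : ℕ) : PowerSeries ℚ) * w ^ m) -
        -(PowerSeries.C (2 : ℚ) * PowerSeries.X ^ 2 * ι)) =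
        θ * (((k + 1 : ℕ) : PowerSeries ℚ) - ((k : ℕ) : PowerSeries ℚ) * w) * w ^ k := by
      have h3 : ι ^ 2 * (PowerSeries.C (2 : ℚ) * PowerSeries.X ^ 2 * ι) = θ := by rw [hθ]; ring
      linear_combination (-θ) * hgeom + h3 - h3
    rw [this]
    -- `θ · w^k` is divisible by `X^{k+2} ⊇ X^{k+1}`
    have hθX : (PowerSeries.X : PowerSeries ℚ) ^ 2 ∣ θ := by
      rw [hθ]; exact Dvd.intro_left (PowerSeries.C (2 : ℚ) * ι ^ 3) (by ring)
    have hθwk : (PowerSeries.X : PowerSeries ℚ) ^ (k + 1) ∣ θ * w ^ k := by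
      have h := mul_dvd_mul hθX (pow_dvd_pow_of_dvd hwX k)
      rw [← pow_add] at h
      exact (pow_dvd_pow _ (by omega : k + 1 ≤ 2 + k)).trans h
    have : θ * (((k + 1 : ℕ) : PowerSeries ℚ) - ((k : ℕ) : PowerSeries ℚ) * w) * w ^ k =
        θ * w ^ k * (((k + 1 : ℕ) : PowerSeries ℚ) - ((k : ℕ) : PowerSeries ℚ) * w) := by ring
    rw [this]
    exact dvd_mul_of_dvd_left hθwk _
  -- combine and read off the coefficient of `X^k`
  have h := dvd_add hdiff1 hdiff2
  rw [sub_add_sub_cancel, ← hQ] at h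
  have hc := (PowerSeries.X_pow_dvd_iff.1 h) k (Nat.lt_succ_self k)
  rw [map_sub, sub_eq_zero, Polynomial.coeff_coe] at hc
  rw [hc, map_neg, show PowerSeries.C (2 : ℚ) * PowerSeries.X ^ 2 * ι = PowerSeries.X ^ 2 * (PowerSeries.C (2 : ℚ) * ι) by ring,
    PowerSeries.coeff_X_pow_mul', if_pos hk, PowerSeries.coeff_C_mul, hι, PowerSeries.coeff_mk]
  obtain ⟨m, rfl⟩ : ∃ m, k = m + 2 := ⟨k - 2, by omega⟩
  rw [Nat.add_sub_cancel, show m + 2 - 1 = m + 1 from rfl, pow_succ]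
  ring

end Algebra

/-! ### Assembly: the symbol pairs of `[X^i] A_K` converge to `(ι, θ)`, and `[d^{k−1}] c_k^{(d)} = (−2)^{k−1}` -/

section Assembly

/-- ★ For every `K` there are symbol polynomials `σ_K ≡ ι = (1+2X)⁻¹` and `τ_K ≡ θ = 2X²(1+2X)⁻³ (mod X^{K+1})` of the family
`d ↦ A_K(N(ℤ^{d+1}))`: the coefficient `[X^i] A_K`, `i ≤ K`, is a polynomial in `d` of degree `≤ i` with `d^i`-coefficient `[X^i]σ_K`
and `d^{i−1}`-coefficient `[X^i]τ_K`. [cite: MadrasSlade1993, §1.1 eq. (1.1.8) p. 5; lane theorem] -/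
theorem exists_symbolPair_coeff_A (K : ℕ) : ∃ σ τ : Polynomial ℚ,
    (PowerSeries.X : PowerSeries ℚ) ^ (K + 1) ∣ ((σ : PowerSeries ℚ) - PowerSeries.mk (fun i : ℕ => (-2 : ℚ) ^ i)) ∧
    (PowerSeries.X : PowerSeries ℚ) ^ (K + 1) ∣ ((τ : PowerSeries ℚ) -
      PowerSeries.C (2 : ℚ) * PowerSeries.X ^ 2 * PowerSeries.mk (fun i : ℕ => (-2 : ℚ) ^ i) ^ 3) ∧
    ∀ i ≤ K, ∃ P : Polynomial ℚ, P.natDegree ≤ i ∧ P.coeff i = σ.coeff i ∧ (P * Polynomial.X).coeff i = τ.coeff i ∧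
      ∀ d : ℕ, (((CostSeries.A (costCoeffZd d) K).coeff i : ℤ) : ℚ) = P.eval (d : ℚ) := by
  induction K with
  | zero =>
    refine ⟨1, 0, ?_, ?_, fun i hi => ?_⟩
    · -- `1 − ι` has constant coefficient `0`
      rw [zero_add, PowerSeries.X_pow_dvd_iff]
      intro m hm
      obtain rfl : m = 0 := by omega
      rw [map_sub, Polynomial.coe_one, PowerSeries.coeff_mk, sub_eq_zero, pow_zero]
      exact PowerSeries.coeff_zero_one
    · rw [zero_add, pow_one, Polynomial.coe_zero, zero_sub, dvd_neg]
      exact Dvd.intro (PowerSeries.C (2 : ℚ) * PowerSeries.X * PowerSeries.mk (fun i : ℕ => (-2 : ℚ) ^ i) ^ 3) (by ring)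
    · obtain ⟨P, hP, hPa, hPb, h⟩ := gsym2_one 0 i hi
      exact ⟨P, hP, hPa, hPb, fun d => by rw [← h d, CostSeries.A]⟩
  | succ K ih =>
    obtain ⟨σ, τ, hσ, hτ, hA⟩ := ih
    obtain ⟨hσ', hτ'⟩ := alg2_A_step hσ hτ
    exact ⟨_, _, hσ', hτ', gsym2_A_succ hA⟩

/-- ★★★ THE LEADING COEFFICIENT: for every `k ≥ 2`, `d ↦ c_k^{(d)} = largeForceCoeffZd d k` is a polynomial over `ℚ` of degree
`≤ k − 1` whose `d^{k−1}`-coefficient is `(−2)^{k−1}` — the lane's observed law `c_k^{(d)} = (−2)^{k−1} d^{k−1} + O(d^{k−2})`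
(`c₂ = −2d`, `c₃ = 4d² + …`, `c₄ = −8d³ − …`, `c₇ = 64d⁶ + …`) for EVERY `k`. Proof: `c_k^{(d)} = [X^k] E_k`, `E_k = Σ_{j≤k} (1 − A_k)^j`;
at top degree `E_k ≡ 1/ι = 1 + 2X` kills `X^k` (`SAWPulledLargeForceExpansionZdTopSymbol`), and at the next degree the second symbol is
`−θ/ι² = −2X²ι`, whose `X^k`-coefficient is `(−2)^{k−1}` (`alg2_E`). [cite: MadrasSlade1993, §1.1 eq. (1.1.8) p. 5; lane theorem] -/
theorem exists_polynomial_largeForceCoeffZd_leadingCoeff {k : ℕ} (hk : 2 ≤ k) :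
    ∃ P : Polynomial ℚ, P.natDegree ≤ k - 1 ∧ P.coeff (k - 1) = (-2 : ℚ) ^ (k - 1) ∧
      ∀ d : ℕ, (largeForceCoeffZd d k : ℚ) = P.eval (d : ℚ) := by
  obtain ⟨σ, τ, hσ, hτ, hA⟩ := exists_symbolPair_coeff_A k
  -- the family `1 − A_k` has symbol pair `(1 − σ, −τ)`; its powers and their sum
  have h1 : ∀ i ≤ k, ∃ P : Polynomial ℚ, P.natDegree ≤ i ∧ P.coeff i = (1 - σ).coeff i ∧
      (P * Polynomial.X).coeff i = (0 - τ).coeff i ∧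
      ∀ d : ℕ, (((1 - CostSeries.A (costCoeffZd d) k).coeff i : ℤ) : ℚ) = P.eval (d : ℚ) :=
    gsym2_sub (S := fun _ => (1 : Polynomial ℤ)) (gsym2_one k) hA
  have hE : ∀ i ≤ k, ∃ P : Polynomial ℚ, P.natDegree ≤ i ∧
      P.coeff i = (∑ j ∈ Finset.range (k + 1), (1 - σ) ^ j).coeff i ∧
      (P * Polynomial.X).coeff i = (∑ j ∈ Finset.range (k + 1), (j : Polynomial ℚ) * (1 - σ) ^ (j - 1) * (0 - τ)).coeff i ∧
      ∀ d : ℕ, (((∑ j ∈ Finset.range (k + 1), (1 - CostSeries.A (costCoeffZd d) k) ^ j).coeff i : ℤ) : ℚ) = P.eval (d : ℚ) :=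
    gsym2_sum (Finset.range (k + 1)) (S := fun j d => (1 - CostSeries.A (costCoeffZd d) k) ^ j) (σ := fun j => (1 - σ) ^ j)
      (τ := fun j => (j : Polynomial ℚ) * (1 - σ) ^ (j - 1) * (0 - τ))
      (fun j _ => gsym2_pow (S := fun d => 1 - CostSeries.A (costCoeffZd d) k) h1 j)
  obtain ⟨P, hP, -, hPb, h⟩ := hE k le_rfl
  have hev : ∀ d : ℕ, (largeForceCoeffZd d k : ℚ) = P.eval (d : ℚ) := fun d => by
    rw [← h d, largeForceCoeffZd, CostSeries.e, CostSeries.E]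
  -- the top coefficient vanishes (degree drop, `SAWPulledLargeForceExpansionZdTopSymbol`), by uniqueness of the polynomial
  obtain ⟨Q, hQ, hQk, hQev⟩ := exists_polynomial_largeForceCoeffZd_topCoeff_zero hk
  have hPQ : P = Q := by
    apply Polynomial.eq_of_infinite_eval_eq P Q
    refine Set.Infinite.mono ?_ (Set.infinite_range_of_injective Nat.cast_injective)
    rintro x ⟨d, rfl⟩
    simp only [Set.mem_setOf_eq]
    rw [← hev d, hQev d]
  have hPk : P.coeff k = 0 := by rw [hPQ, hQk]
  -- the second coefficient
  have hsec : P.coeff (k - 1) = (-2 : ℚ) ^ (k - 1) := by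
    obtain ⟨m, rfl⟩ : ∃ m, k = m + 1 := ⟨k - 1, by omega⟩
    rw [Nat.add_sub_cancel, ← Polynomial.coeff_mul_X, hPb]
    exact alg2_E hk hσ hτ
  refine ⟨P, ?_, hsec, hev⟩
  -- degree ≤ k with vanishing top coefficient
  by_contra hlt
  have hdeg : P.natDegree = k := le_antisymm hP (by omega)
  have hP0 : P ≠ 0 := by
    rintro rfl
    simp at hdeg
    omega
  have hlead : P.leadingCoeff = 0 := by rw [Polynomial.leadingCoeff, hdeg, hPk]
  exact hP0 (Polynomial.leadingCoeff_eq_zero.1 hlead)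

/-- ★★★ Hence `deg_d c_k^{(d)} = k − 1` EXACTLY, with leading coefficient `(−2)^{k−1}`, for every `k ≥ 2`.
[cite: MadrasSlade1993, §1.1 eq. (1.1.8) p. 5; lane theorem] -/
theorem exists_polynomial_largeForceCoeffZd_natDegree_eq {k : ℕ} (hk : 2 ≤ k) :
    ∃ P : Polynomial ℚ, P.natDegree = k - 1 ∧ P.leadingCoeff = (-2 : ℚ) ^ (k - 1) ∧
      ∀ d : ℕ, (largeForceCoeffZd d k : ℚ) = P.eval (d : ℚ) := by
  obtain ⟨P, hP, hPc, hev⟩ := exists_polynomial_largeForceCoeffZd_leadingCoeff hk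
  have hne : P.coeff (k - 1) ≠ 0 := by rw [hPc]; exact pow_ne_zero _ (by norm_num)
  have hdeg : P.natDegree = k - 1 := le_antisymm hP (Polynomial.le_natDegree_of_ne_zero hne)
  exact ⟨P, hdeg, by rw [Polynomial.leadingCoeff, hdeg, hPc], hev⟩

end Assembly
end Literature.Probability.RandomPlanarGeometry.SAW.Zd
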